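import Literature.AnabelianGeometry.SemiGraphs.TemperedEdgeLikeDistinctProofsAt
import HarnessLib

/-!
# [SemiAnbd] Thm 3.7: `EdgeLikeDistinct` from (i), (ii), (iii) — PER-GRAPH twin (cell ruling φ2 / α4-3 (ii))

Mochizuki, *Semi-graphs of anabelioids*, Publ. RIMS **42** (2006), §3, Theorem 3.7 (ii)–(iv), manuscript
pp. 40–41 [cite: MochizukiSemiAnbd2006, Thm 3.7(iii)(iv) pp.40-41].

PROOF-ONLY companion of `TemperedEdgeLikeDistinctOf.lean` (abc-iut cell wave-4 seat abc-iut-w4-d075, L3-lead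
ruling α4-3 (ii)
«φ2-CONSUMERS»): the same theorems with the ∀-countable named facts `CompactInVerticial` /
`MaximalCompactIffVerticial` / `EdgeLikeIsInfVerticial` / `EdgeLikeDistinct` replaced by their per-graph
forms `…At 𝒢` (`TemperedCompactInVerticialAt.lean`), so that the finite-`𝔾` producer
(`compactInVerticialAt_of_finiteLevelData`) feeds them; proofs ported VERBATIM with `hCV 𝒢 ↦ hCV`
(the `Thm37Hypotheses` argument stays).  Original file untouched.  No definitions, no new named fact;
nothing here asserts Thm 3.7 (iii) for an infinite `𝔾`, and nothing bears on [IUTchIII] Cor. 3.12.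
-/

namespace Literature.AnabelianGeometry.SemiGraphs

namespace ProfiniteSemiGraph

open Topology

universe u w

variable {𝒢 ℋ : ProfiniteSemiGraph.{u}}

/-- **`EdgeLikeDistinct` from Thm 3.7 (i), (ii), (iii).** [cite: MochizukiSemiAnbd2006, Thm 3.7(iv) p.41] -/
theorem edgeLikeDistinctAt_of (hCV : CompactInVerticialAt 𝒢) (hVD : VerticialDistinct.{u})
    (hVI : VerticialInjective.{u}) : EdgeLikeDistinctAt 𝒢 :=
  fun h𝒢 c _ _ _ _ hL₁ hL₂ hne => relIndex_edgeLike_eq_zero_at hCV hVD hVI h𝒢 c hne hL₁ hL₂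

end ProfiniteSemiGraph

end Literature.AnabelianGeometry.SemiGraphs
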